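/-
Copyright: statement-level skeleton of a published paper (lit-balaban cell, Phase-2 proof seat p10, gen 3). No proof claims
beyond what the kernel checks below.
-/
import Mathlib
import Literature.MathematicalPhysics.QuantumFieldTheory.BalabanImbrieJaffe1984to88.BIJ85Sect7Statements
import Literature.MathematicalPhysics.QuantumFieldTheory.BalabanImbrieJaffe1984to88.BIJ85Tau0Positivity729
import Literature.MathematicalPhysics.QuantumFieldTheory.BalabanImbrieJaffe1984to88.BIJ85SigmaOnCurls325

/-!
# `BalabanImbrieJaffe1984to88.BIJ85Prop712Fibre` — T. Bałaban, J. Imbrie, A. Jaffe, *Renormalization of the Higgs model: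
minimizers, propagators and the stability of mean field theory*, Commun. Math. Phys. **97** (1985) 299–329
[BalabanImbrieJaffe1985]: Sect. 7.1 p. 324 — **Proposition 7.1.2 at one momentum fibre**, for the CONCRETE symbols
σ_k(p) = τ₁(p) + τ₂(p) of (7.1.13)–(7.1.16): (7.1.23) ⇒ (7.1.24) ‖τ₂‖ ≤ M, the reduction ⟨f,τ₁f⟩ = ⟨f^⊥,τ₁f^⊥⟩ (τ₁∂ = 0), the
cross-term bound ⟨f,τ₂f⟩ ≥ ⟨∂B,τ₂∂B⟩ − 2M‖∂B‖‖f^⊥‖, and the printed argument (7.1.25)–(7.1.27) applied — PROVED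

statement-level skeleton of published theorems with citation tags; proofs where landed; nothing here is a claim about
the Yang–Mills mass gap

PDF held: `paper:balaban1985-cmp97-bij-higgs-minimizers` (journal page = PDF page + 298).  Renders read as images: PDF pp.
25–27 (journal 323–325), `run/shared/lean/pub/pub-balaban/t4/b2b-balaban-t4-lit2/renders/bij1985/…-p025…p027-x2.png`.

CITATION HEADER (lean-in-tree rule).  Part of the lit-balaban TYPED SKELETON (HOME `run/shared/lean/pub/lit-balaban/`); WHAT IS
REPRODUCED: the proof of SKELETON row **C1.Prop7.1.2** (*"Proposition 7.1.2 (7.1.21) … Proof (7.1.22)–(7.1.27)"*,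
`HOME/lit-balaban-r15/ROWS-C1.md`, fold owner r15, referee ref-5) at ONE momentum fibre, file 2/3 of seat p10 gen 3's model
instance of Proposition 7.1.2 / Theorem 7.1.1 (file 1 `BIJ85AveragingSums716` = the estimates behind (7.1.23); file 3
`BIJ85Thm711Fibrewise` = (7.1.23) with its constant, the `FibreData` model, `Prop712`, `Ineq7121`, `Thm711`).
THE PRINTED TEXT (p. 324 [PDF 26], verbatim): *"The inequality |a_μ(p)/φ_ν(p)^{1/2}| ≤ c₂ (7.1.23) is an extension of (7.1.20).
As a consequence, ‖τ₂‖ ≤ M, (7.1.24) where M is a constant independent of p and k. Let us now decompose σ_k(p) according to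
(7.1.19). For f = ∂B + f^⊥ ∈ 𝒦(p), write ⟨f,σ_kf⟩ = ⟨f,τ₁f⟩ + ⟨f,τ₂f⟩ = ⟨f^⊥,τ₁f^⊥⟩ + ⟨f,τ₂f⟩ ≥ … (7.1.25) Here we use τ₁∂ = 0
and the hypothesis on τ₁. … 0 ≤ τ₂ is evident from (7.1.15). … Note that by (7.1.24) and the positivity of τ₂, ⟨f,τ₂f⟩ =
⟨∂B,τ₂∂B⟩ + ⟨∂B,τ₂f^⊥⟩ + ⟨f^⊥,τ₂∂B⟩ + ⟨f^⊥,τ₂f^⊥⟩ ≥ ⟨∂B,τ₂∂B⟩ − 2M‖∂B‖‖f^⊥‖. … Let δ > 0 and c ≡ ½δε > 0. Then ⟨f,σ_kf⟩ ≥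
c(‖f^⊥‖² + ‖∂B‖²) = c‖f‖², as desired and completes the proof of the proposition."*

Inputs (read-only): r15's `BIJ85MomentumSymbols71` ((7.1.3) `tensorInner`, (7.1.14) `tau1Sym`, (7.1.15) `tau2Sym`, (7.1.16)
`aSym`, (7.1.10) `phiSym`, `curlOne`, (7.1.18) `tau1Sym_curl`) and `BIJ85Sect7Statements.prop712_core` ((7.1.25)–(7.1.27),
kernel-checked by r15); gen-2 `BIJ85CurlComplement719` (`normSq`, the bracket `projK`), `BIJ85Tau0Positivity729` (`lKernel`,
`tau0`, (7.1.28) `ineq7128`), `BIJ85Tau2Kernel715` (τ₂-form = ‖P(Dh)‖², `tau2_nonneg`, `hVec`, `scl`, `enn`),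
`BIJ85SigmaOnCurls325` (`tau2Sym_eq_kernel`, `tensorInner_eq_sum₂`).

WHAT IS KERNEL-CHECKED (zero `sorry`, standard axioms; this file introduces no definitions):
* §1 algebra of the pairing (7.1.3): sesquilinearity, additivity in the kernel (σ_k = τ₁ + τ₂), Hermitian symmetry for
  Hermitian kernels; τ₁ (7.1.14) IS Hermitian (`tau1Sym_conj_symm`), hence with τ₁∂ = 0: **⟨∂B + g, τ₁(∂B + g)⟩ = ⟨g, τ₁g⟩**
  for every g (`tau1_form_reduce`) — the step "= ⟨f^⊥,τ₁f^⊥⟩" of (7.1.25);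
* §2 **(7.1.23) ⇒ (7.1.24)** for the τ₂ of (7.1.15) with generic data (a, ∂^{(1)}, φ): ⟨f,τ₂f⟩ = ‖P(Dh)‖² ≤ ‖Dh‖² ≤ d·c₂²·‖f‖² when
  |a_λ|² ≤ c₂²φ_κ for all λ, κ (`tau2_form_le`: ‖τ₂‖ ≤ M := d·c₂² as a form bound), and the cross-term inequality of p. 324
  ⟨c + g, τ₂(c + g)⟩ ≥ ⟨c,τ₂c⟩ − 2M‖c‖‖g‖ (`tau2_form_cross`, from ‖X + Y‖ ≥ ‖X‖ − ‖Y‖ and Cauchy–Schwarz);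
* §3 **Proposition 7.1.2 at one fibre** (`prop712_fibre`): at a momentum p′ with the generic-momentum provisos of r15's
  (7.1.18), φ(p′) > 0, and (7.1.23) at constant c₂², for EVERY splitting f = ∂B + g with ε‖g‖² ≤ ⟨g,τ₀g⟩ and ε‖∂B‖² ≤
  ⟨∂B,τ₂∂B⟩ (the two members of (7.1.21) for this f): c′‖f‖² ≤ ⟨f,(τ₁ + τ₂)f⟩ with c′ = ¼·min{1,(ε/2M)²}·ε, M = d·c₂² — the
  printed c = ½δε up to the factor ½ by which we replace the ( , )-orthogonality ‖f‖² = ‖f^⊥‖² + ‖∂B‖² of (7.1.19b) with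
  ‖f‖² ≤ 2(‖∂B‖² + ‖g‖²) in the norm of (7.1.25)–(7.1.27).
NOT here: (7.1.23) itself and the uniformity of its constant (files 1, 3); the choice of f^⊥ ((7.1.19), gen-2
`exists_decomp719`) and the verification (7.1.28)–(7.1.31) of (7.1.21) (file 3).  Unit `lit-balaban-p10` (gen 3), HOME as above.
-/

namespace Literature.MathematicalPhysics.QuantumFieldTheory.BalabanImbrieJaffe1984to88.BIJ85Prop712Fibre

open scoped BigOperators Real ComplexConjugate Matrix
open Finset Matrix
open Literature.MathematicalPhysics.QuantumFieldTheory.BalabanImbrieJaffe1984to88.BIJ85MomentumSymbols71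
open Literature.MathematicalPhysics.QuantumFieldTheory.BalabanImbrieJaffe1984to88.BIJ85CurlComplement719
open Literature.MathematicalPhysics.QuantumFieldTheory.BalabanImbrieJaffe1984to88.BIJ85Tau0Positivity729
open Literature.MathematicalPhysics.QuantumFieldTheory.BalabanImbrieJaffe1984to88.BIJ85Tau2Kernel715
open Literature.MathematicalPhysics.QuantumFieldTheory.BalabanImbrieJaffe1984to88.BIJ85SigmaOnCurls325

noncomputable section

variable {d : ℕ}

/-! ## §1 Algebra of the pairing (7.1.3); τ₁ is Hermitian; ⟨f,τ₁f⟩ = ⟨f^⊥,τ₁f^⊥⟩ -/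

/-- (7.1.3) is additive in the left slot. [cite: BalabanImbrieJaffe1985, (7.1.3) p.321] -/
theorem tensorInner_add_left (f f' g : Fin d → Fin d → ℂ) (T : Fin d → Fin d → Fin d → Fin d → ℂ) :
    tensorInner (f + f') T g = tensorInner f T g + tensorInner f' T g := by
  simp only [tensorInner, Pi.add_apply, map_add, add_mul, Finset.sum_add_distrib]

/-- (7.1.3) is additive in the right slot. [cite: BalabanImbrieJaffe1985, (7.1.3) p.321] -/
theorem tensorInner_add_right (f g g' : Fin d → Fin d → ℂ) (T : Fin d → Fin d → Fin d → Fin d → ℂ) :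
    tensorInner f T (g + g') = tensorInner f T g + tensorInner f T g' := by
  simp only [tensorInner, Pi.add_apply, mul_add, Finset.sum_add_distrib]

/-- (7.1.3) is additive in the kernel: ⟨f,(τ₁ + τ₂)g⟩ = ⟨f,τ₁g⟩ + ⟨f,τ₂g⟩ (σ_k = τ₁ + τ₂, (7.1.13)). [cite: BalabanImbrieJaffe1985, (7.1.13) p.322] -/
theorem tensorInner_add_kernel (f g : Fin d → Fin d → ℂ) (T T' : Fin d → Fin d → Fin d → Fin d → ℂ) :
    tensorInner f (fun μ ν l κ => T μ ν l κ + T' μ ν l κ) g = tensorInner f T g + tensorInner f T' g := by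
  simp only [tensorInner, mul_add, add_mul, Finset.sum_add_distrib]

/-- kernel: exchanging the index pairs (μ,ν) ↔ (λ,κ) of a fourfold sum. [folklore] -/
private theorem sum4_swap (F : Fin d → Fin d → Fin d → Fin d → ℂ) :
    ∑ μ, ∑ ν, ∑ l, ∑ κ, F μ ν l κ = ∑ l, ∑ κ, ∑ μ, ∑ ν, F μ ν l κ := by
  calc ∑ μ, ∑ ν, ∑ l, ∑ κ, F μ ν l κ = ∑ μ, ∑ l, ∑ ν, ∑ κ, F μ ν l κ :=
        Finset.sum_congr rfl fun μ _ => Finset.sum_comm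
    _ = ∑ l, ∑ μ, ∑ ν, ∑ κ, F μ ν l κ := Finset.sum_comm
    _ = ∑ l, ∑ μ, ∑ κ, ∑ ν, F μ ν l κ :=
        Finset.sum_congr rfl fun l _ => Finset.sum_congr rfl fun μ _ => Finset.sum_comm
    _ = ∑ l, ∑ κ, ∑ μ, ∑ ν, F μ ν l κ := Finset.sum_congr rfl fun l _ => Finset.sum_comm

/-- For a Hermitian kernel (\overline{T_{μνλκ}} = T_{λκμν}) the pairing (7.1.3) is Hermitian: \overline{⟨f,Tg⟩} = ⟨g,Tf⟩.
[cite: BalabanImbrieJaffe1985, (7.1.3) p.321] -/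
theorem tensorInner_conj_symm {T : Fin d → Fin d → Fin d → Fin d → ℂ} (hT : ∀ μ ν l κ, conj (T μ ν l κ) = T l κ μ ν)
    (f g : Fin d → Fin d → ℂ) : conj (tensorInner f T g) = tensorInner g T f := by
  unfold tensorInner
  simp only [map_sum, map_mul, Complex.conj_conj, hT]
  rw [sum4_swap]
  exact Finset.sum_congr rfl fun l _ => Finset.sum_congr rfl fun κ _ => Finset.sum_congr rfl fun μ _ =>
    Finset.sum_congr rfl fun ν _ => by ring

/-- If T kills c (Σ_{λκ}T_{μνλκ}c_{λκ} = 0 for all μ, ν) then ⟨x,Tc⟩ = 0. [cite: BalabanImbrieJaffe1985, (7.1.18) p.323] -/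
theorem tensorInner_eq_zero_of_apply {T : Fin d → Fin d → Fin d → Fin d → ℂ} {c : Fin d → Fin d → ℂ}
    (hTc : ∀ μ ν, ∑ l, ∑ κ, T μ ν l κ * c l κ = 0) (x : Fin d → Fin d → ℂ) : tensorInner x T c = 0 := by
  rw [tensorInner_eq_sum₂]
  exact Finset.sum_eq_zero fun μ _ => Finset.sum_eq_zero fun ν _ => by rw [hTc, mul_zero]

/-- … and, T being Hermitian, also ⟨c,Tx⟩ = 0. [cite: BalabanImbrieJaffe1985, (7.1.18) p.323] -/
theorem tensorInner_eq_zero_of_apply_left {T : Fin d → Fin d → Fin d → Fin d → ℂ}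
    (hT : ∀ μ ν l κ, conj (T μ ν l κ) = T l κ μ ν) {c : Fin d → Fin d → ℂ}
    (hTc : ∀ μ ν, ∑ l, ∑ κ, T μ ν l κ * c l κ = 0) (x : Fin d → Fin d → ℂ) : tensorInner c T x = 0 := by
  rw [← tensorInner_conj_symm hT, tensorInner_eq_zero_of_apply hTc, map_zero]

/-- Hence for Hermitian T killing c: ⟨c + g, T(c + g)⟩ = ⟨g, Tg⟩ — the step *"⟨f,τ₁f⟩ = ⟨f^⊥,τ₁f^⊥⟩ … Here we use τ₁∂ = 0"*
of (7.1.25), for ANY complement g. [cite: BalabanImbrieJaffe1985, (7.1.25) p.324] -/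
theorem tensorInner_add_self_of_apply {T : Fin d → Fin d → Fin d → Fin d → ℂ}
    (hT : ∀ μ ν l κ, conj (T μ ν l κ) = T l κ μ ν) {c : Fin d → Fin d → ℂ}
    (hTc : ∀ μ ν, ∑ l, ∑ κ, T μ ν l κ * c l κ = 0) (g : Fin d → Fin d → ℂ) :
    tensorInner (c + g) T (c + g) = tensorInner g T g := by
  rw [tensorInner_add_left, tensorInner_add_right, tensorInner_add_right, tensorInner_eq_zero_of_apply hTc,
    tensorInner_eq_zero_of_apply hTc, tensorInner_eq_zero_of_apply_left hT hTc, zero_add, zero_add, zero_add]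

/-- The bracket of (7.1.14) is Hermitian entrywise: \overline{P_{μλ}} = P_{λμ}. [cite: BalabanImbrieJaffe1985, (7.1.14) p.322] -/
theorem projK_conj (e : Fin d → ℂ) (μ l : Fin d) : conj (projK e μ l) = projK e l μ := by
  have h := congrFun (congrFun (projK_conjTranspose e) l) μ
  rwa [Matrix.conjTranspose_apply, Complex.star_def] at h

/-- The l-terms of τ₁ (7.1.14) are Hermitian kernels: \overline{(|u|²/(v̄_μv̄_νv_λv_κ)P_{μλ}P_{νκ})} = the (λκμν) entry.
[cite: BalabanImbrieJaffe1985, (7.1.14) p.322] -/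
theorem lKernel_conj_symm (u : ℂ) (v e : Fin d → ℂ) (μ ν l κ : Fin d) :
    conj (lKernel u v e μ ν l κ) = lKernel u v e l κ μ ν := by
  simp only [lKernel, map_mul, map_div₀, Complex.conj_ofReal, Complex.conj_conj, projK_conj]
  ring

/-- **τ₁(p′) (7.1.14) is a Hermitian kernel.** [cite: BalabanImbrieJaffe1985, (7.1.14) p.322] -/
theorem tau1Sym_conj_symm (η : ℝ) (M : ℕ) (p' : Fin d → ℝ) (μ ν l κ : Fin d) :
    conj (tau1Sym η M p' μ ν l κ) = tau1Sym η M p' l κ μ ν := by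
  simp only [tau1Sym, map_mul, map_sum, map_div₀, map_one, map_ofNat, tau1Term_eq_lKernel, lKernel_conj_symm]

/-- **(7.1.25), first step**, for r15's τ₁: ⟨∂B + g, τ₁(p′)(∂B + g)⟩ = ⟨g, τ₁(p′)g⟩ for every one-form B and EVERY two-form g
(τ₁∂ = 0, (7.1.18), at the generic momenta of r15's `tau1Sym_curl`; τ₁ Hermitian). [cite: BalabanImbrieJaffe1985, (7.1.25) p.324] -/
theorem tau1_form_reduce (η : ℝ) (M : ℕ) (p' : Fin d → ℝ) (hp : ∀ i : Fin d, dOne p' i ≠ 0)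
    (hΔ : ∀ m ∈ lShifts d M, lapSym η (shiftMom p' m) ≠ 0)
    (hq : ∀ m ∈ lShifts d M, ∀ i : Fin d, dSym η (shiftMom p' m) i ≠ 0) (B : Fin d → ℂ) (g : Fin d → Fin d → ℂ) :
    tensorInner (curlOne p' B + g) (tau1Sym η M p') (curlOne p' B + g) = tensorInner g (tau1Sym η M p') g :=
  tensorInner_add_self_of_apply (tau1Sym_conj_symm η M p') (tau1Sym_curl η M p' hp hΔ hq B) g

/-! ## §2 (7.1.23) ⇒ (7.1.24): τ₂ is the square of a norm, bounded by d·c₂² -/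

/-- kernel: for a self-adjoint idempotent matrix M, x̄·(Mx) = Σ|(Mx)_i|². [folklore] -/
private theorem star_dot_mulVec_of_proj {ι : Type*} [Fintype ι] [DecidableEq ι] (M : Matrix ι ι ℂ) (hM : Mᴴ = M)
    (hM2 : M * M = M) (x : ι → ℂ) :
    star x ⬝ᵥ (M *ᵥ x) = ((∑ i, ‖(M *ᵥ x) i‖ ^ 2 : ℝ) : ℂ) := by
  have h : star x ⬝ᵥ (M *ᵥ x) = star (M *ᵥ x) ⬝ᵥ (M *ᵥ x) := by
    rw [Matrix.star_mulVec, hM, ← Matrix.dotProduct_mulVec, Matrix.mulVec_mulVec, hM2]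
  rw [h]
  simp only [dotProduct, Pi.star_apply, Complex.star_def, Complex.conj_mul']
  push_cast
  rfl

/-- A bracket [ ] of (7.1.14)/(7.1.15) contracts: Σ_i|(P y)_i|² ≤ Σ_i|y_i|² (‖y‖² = ‖Py‖² + ‖(1 − P)y‖², P and 1 − P being
orthogonal projections). [cite: BalabanImbrieJaffe1985, (7.1.15) p.323] -/
theorem normSq_projK_mulVec_le (e y : Fin d → ℂ) : ∑ i, ‖(projK e *ᵥ y) i‖ ^ 2 ≤ ∑ i, ‖y i‖ ^ 2 := by
  set P := projK e with hP
  have hPh : Pᴴ = P := projK_conjTranspose e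
  have hP2 : P * P = P := projK_mul_projK e
  have hQh : (1 - P)ᴴ = 1 - P := by rw [Matrix.conjTranspose_sub, Matrix.conjTranspose_one, hPh]
  have hQ2 : (1 - P) * (1 - P) = 1 - P := by
    rw [sub_mul, mul_sub, mul_sub, Matrix.one_mul, Matrix.mul_one, Matrix.one_mul, hP2, sub_self, sub_zero]
  have h1 : star y ⬝ᵥ ((1 : Matrix (Fin d) (Fin d) ℂ) *ᵥ y) = ((∑ i, ‖y i‖ ^ 2 : ℝ) : ℂ) := by
    rw [star_dot_mulVec_of_proj 1 Matrix.conjTranspose_one (Matrix.mul_one 1) y, Matrix.one_mulVec]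
  have hsplit : star y ⬝ᵥ ((1 : Matrix (Fin d) (Fin d) ℂ) *ᵥ y) = star y ⬝ᵥ (P *ᵥ y) + star y ⬝ᵥ ((1 - P) *ᵥ y) := by
    rw [← dotProduct_add, ← Matrix.add_mulVec, add_sub_cancel]
  rw [h1, star_dot_mulVec_of_proj P hPh hP2, star_dot_mulVec_of_proj (1 - P) hQh hQ2] at hsplit
  have h := congrArg Complex.re hsplit
  simp only [Complex.ofReal_re, Complex.add_re] at h
  have h0 : 0 ≤ ∑ i, ‖((1 - P) *ᵥ y) i‖ ^ 2 := Finset.sum_nonneg fun _ _ => sq_nonneg _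
  linarith

/-- The contraction h (`hVec`) of (7.1.15) is additive in the two-form. [cite: BalabanImbrieJaffe1985, (7.1.15) p.323] -/
theorem hVec_add (a : Fin d → ℂ) (X Y : Fin d → Fin d → ℂ) : hVec a (X + Y) = hVec a X + hVec a Y := by
  funext κ
  simp only [hVec, Pi.add_apply, mul_add, Finset.sum_add_distrib]

/-- The rescaling D = diag(φ^{−1/2}) is additive. [cite: BalabanImbrieJaffe1985, (7.1.15) p.323] -/
theorem scl_add (φ : Fin d → ℝ) (x y : Fin d → ℂ) : scl φ (x + y) = scl φ x + scl φ y := by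
  funext ν
  simp only [scl, Pi.add_apply, mul_add]

/-- Hence f ↦ P(D h(f)) is additive. [cite: BalabanImbrieJaffe1985, (7.1.15) p.323] -/
theorem proj_scl_hVec_add (a e : Fin d → ℂ) (φ : Fin d → ℝ) (X Y : Fin d → Fin d → ℂ) :
    projK (scl φ e) *ᵥ scl φ (hVec a (X + Y))
      = projK (scl φ e) *ᵥ scl φ (hVec a X) + projK (scl φ e) *ᵥ scl φ (hVec a Y) := by
  rw [hVec_add, scl_add, Matrix.mulVec_add]

/-- ‖D h(f)‖² ≤ d·c₂²·‖f‖² when |a_λ|² ≤ c₂²φ_κ for all λ, κ ((7.1.23)): |h_κ|² ≤ (Σ_λ|a_λ|²)(Σ_λ|f_{λκ}|²) by Cauchy–Schwarz.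
[cite: BalabanImbrieJaffe1985, (7.1.24) p.324] -/
theorem normSq_scl_hVec_le {a : Fin d → ℂ} {φ : Fin d → ℝ} (hφ : ∀ μ, 0 < φ μ) {C : ℝ}
    (hc : ∀ l κ, ‖a l‖ ^ 2 ≤ C * φ κ) (X : Fin d → Fin d → ℂ) :
    ∑ κ, ‖scl φ (hVec a X) κ‖ ^ 2 ≤ d * C * normSq X := by
  have hterm : ∀ κ, ‖scl φ (hVec a X) κ‖ ^ 2 ≤ d * C * ∑ l, ‖X l κ‖ ^ 2 := fun κ => by
    rw [norm_scl_sq hφ, div_le_iff₀ (hφ κ)]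
    have h1 : ‖hVec a X κ‖ ≤ ∑ l, ‖a l‖ * ‖X l κ‖ := by
      unfold hVec
      refine (norm_sum_le _ _).trans (Finset.sum_le_sum fun l _ => ?_)
      rw [norm_mul, Complex.norm_conj]
    have h2 : (∑ l, ‖a l‖ * ‖X l κ‖) ^ 2 ≤ (∑ l, ‖a l‖ ^ 2) * ∑ l, ‖X l κ‖ ^ 2 :=
      Finset.sum_mul_sq_le_sq_mul_sq _ _ _
    have h3 : ∑ l, ‖a l‖ ^ 2 ≤ d * (C * φ κ) := by
      calc ∑ l, ‖a l‖ ^ 2 ≤ ∑ _l : Fin d, C * φ κ := Finset.sum_le_sum fun l _ => hc l κ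
        _ = d * (C * φ κ) := by rw [Finset.sum_const, Finset.card_univ, Fintype.card_fin, nsmul_eq_mul]
    have h4 : 0 ≤ ∑ l, ‖X l κ‖ ^ 2 := Finset.sum_nonneg fun _ _ => sq_nonneg _
    calc ‖hVec a X κ‖ ^ 2 ≤ (∑ l, ‖a l‖ * ‖X l κ‖) ^ 2 := pow_le_pow_left₀ (norm_nonneg _) h1 2
      _ ≤ (∑ l, ‖a l‖ ^ 2) * ∑ l, ‖X l κ‖ ^ 2 := h2
      _ ≤ d * (C * φ κ) * ∑ l, ‖X l κ‖ ^ 2 := mul_le_mul_of_nonneg_right h3 h4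
      _ = d * C * (∑ l, ‖X l κ‖ ^ 2) * φ κ := by ring
  calc ∑ κ, ‖scl φ (hVec a X) κ‖ ^ 2 ≤ ∑ κ, d * C * ∑ l, ‖X l κ‖ ^ 2 := Finset.sum_le_sum fun κ _ => hterm κ
    _ = d * C * normSq X := by rw [← Finset.mul_sum, normSq, Finset.sum_comm]

/-- **(7.1.24)** p. 324 [PDF 26], verbatim: *"As a consequence, ‖τ₂‖ ≤ M, (7.1.24) where M is a constant independent of p
and k."* — PROVED as a form bound for the τ₂ of (7.1.15) with generic data (a, ∂^{(1)} = e, φ > 0, N = Σ|e_ρ|²/φ_ρ ≠ 0) from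
the (7.1.23)-shaped hypothesis |a_λ|² ≤ c₂²φ_κ: 0 ≤ ⟨f,τ₂f⟩ ≤ M‖f‖² with **M = d·c₂²** (⟨f,τ₂f⟩ = ‖P(Dh)‖² ≤ ‖Dh‖²).
[cite: BalabanImbrieJaffe1985, (7.1.24) p.324] -/
theorem tau2_form_le {a e : Fin d → ℂ} {φ : Fin d → ℝ} (hφ : ∀ μ, 0 < φ μ) (hN : enn e φ ≠ 0) {C : ℝ}
    (hc : ∀ l κ, ‖a l‖ ^ 2 ≤ C * φ κ) (X : Fin d → Fin d → ℂ) :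
    (tensorInner X (tau2Kernel a e φ) X).re ≤ d * C * normSq X := by
  rw [tensorInner_tau2Kernel_eq_normSq hφ hN, Complex.ofReal_re]
  exact (normSq_projK_mulVec_le _ _).trans (normSq_scl_hVec_le hφ hc X)

/-- kernel: Σ_i|X_i + Y_i|² ≥ Σ|X_i|² − 2√(Σ|X_i|²)√(Σ|Y_i|²) (triangle inequality and Cauchy–Schwarz). [folklore] -/
private theorem sum_norm_add_sq_ge (X Y : Fin d → ℂ) :
    (∑ i, ‖X i‖ ^ 2) - 2 * Real.sqrt (∑ i, ‖X i‖ ^ 2) * Real.sqrt (∑ i, ‖Y i‖ ^ 2) ≤ ∑ i, ‖(X + Y) i‖ ^ 2 := by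
  have h1 : ∀ i, ‖X i‖ ^ 2 - 2 * (‖X i‖ * ‖Y i‖) ≤ ‖(X + Y) i‖ ^ 2 := fun i => by
    have h := abs_norm_sub_norm_le (X i) (-(Y i))
    rw [norm_neg, sub_neg_eq_add] at h
    have h' : (‖X i‖ - ‖Y i‖) ^ 2 ≤ ‖X i + Y i‖ ^ 2 := by
      rw [← sq_abs (‖X i‖ - ‖Y i‖)]
      exact pow_le_pow_left₀ (abs_nonneg _) h 2
    rw [Pi.add_apply]
    nlinarith [sq_nonneg ‖Y i‖]
  have h2 : ∑ i, ‖X i‖ * ‖Y i‖ ≤ Real.sqrt (∑ i, ‖X i‖ ^ 2) * Real.sqrt (∑ i, ‖Y i‖ ^ 2) := by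
    rw [← Real.sqrt_mul (Finset.sum_nonneg fun _ _ => sq_nonneg _)]
    refine (Real.le_sqrt (Finset.sum_nonneg fun _ _ => mul_nonneg (norm_nonneg _) (norm_nonneg _))
      (mul_nonneg (Finset.sum_nonneg fun _ _ => sq_nonneg _) (Finset.sum_nonneg fun _ _ => sq_nonneg _))).mpr ?_
    exact Finset.sum_mul_sq_le_sq_mul_sq _ _ _
  have h3 : ∑ i, (‖X i‖ ^ 2 - 2 * (‖X i‖ * ‖Y i‖)) ≤ ∑ i, ‖(X + Y) i‖ ^ 2 := Finset.sum_le_sum fun i _ => h1 i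
  rw [Finset.sum_sub_distrib, ← Finset.mul_sum] at h3
  linarith

/-- p. 324, verbatim: *"Note that by (7.1.24) and the positivity of τ₂, ⟨f,τ₂f⟩ = ⟨∂B,τ₂∂B⟩ + ⟨∂B,τ₂f^⊥⟩ + ⟨f^⊥,τ₂∂B⟩ +
⟨f^⊥,τ₂f^⊥⟩ ≥ ⟨∂B,τ₂∂B⟩ − 2M‖∂B‖‖f^⊥‖."* — PROVED for the τ₂ of (7.1.15) (generic data as in `tau2_form_le`, M = d·c₂²) and ANY
two two-forms c, g in place of ∂B, f^⊥: ⟨c + g, τ₂(c + g)⟩ ≥ ⟨c,τ₂c⟩ − 2M‖c‖‖g‖ (via ⟨f,τ₂f⟩ = ‖P(Dh(f))‖²).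
[cite: BalabanImbrieJaffe1985, (7.1.24) p.324] -/
theorem tau2_form_cross {a e : Fin d → ℂ} {φ : Fin d → ℝ} (hφ : ∀ μ, 0 < φ μ) (hN : enn e φ ≠ 0) {C : ℝ}
    (hc : ∀ l κ, ‖a l‖ ^ 2 ≤ C * φ κ) (c g : Fin d → Fin d → ℂ) :
    (tensorInner c (tau2Kernel a e φ) c).re - 2 * (d * C) * Real.sqrt (normSq c) * Real.sqrt (normSq g)
      ≤ (tensorInner (c + g) (tau2Kernel a e φ) (c + g)).re := by
  have hC : 0 ≤ d * C := by
    rcases Nat.eq_zero_or_pos d with hd | hd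
    · subst hd; simp
    · have h := hc ⟨0, hd⟩ ⟨0, hd⟩
      have : 0 ≤ C := by
        by_contra hneg
        have : C * φ ⟨0, hd⟩ < 0 := mul_neg_of_neg_of_pos (lt_of_not_ge hneg) (hφ _)
        linarith [sq_nonneg ‖a ⟨0, hd⟩‖]
      positivity
  rw [tensorInner_tau2Kernel_eq_normSq hφ hN, tensorInner_tau2Kernel_eq_normSq hφ hN, Complex.ofReal_re,
    Complex.ofReal_re, proj_scl_hVec_add]
  set X := projK (scl φ e) *ᵥ scl φ (hVec a c) with hX
  set Y := projK (scl φ e) *ᵥ scl φ (hVec a g) with hY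
  have hXb : ∑ i, ‖X i‖ ^ 2 ≤ d * C * normSq c := (normSq_projK_mulVec_le _ _).trans (normSq_scl_hVec_le hφ hc c)
  have hYb : ∑ i, ‖Y i‖ ^ 2 ≤ d * C * normSq g := (normSq_projK_mulVec_le _ _).trans (normSq_scl_hVec_le hφ hc g)
  have hsX : Real.sqrt (∑ i, ‖X i‖ ^ 2) ≤ Real.sqrt (d * C) * Real.sqrt (normSq c) := by
    rw [← Real.sqrt_mul hC]; exact Real.sqrt_le_sqrt hXb
  have hsY : Real.sqrt (∑ i, ‖Y i‖ ^ 2) ≤ Real.sqrt (d * C) * Real.sqrt (normSq g) := by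
    rw [← Real.sqrt_mul hC]; exact Real.sqrt_le_sqrt hYb
  have hprod : Real.sqrt (∑ i, ‖X i‖ ^ 2) * Real.sqrt (∑ i, ‖Y i‖ ^ 2)
      ≤ (d * C) * Real.sqrt (normSq c) * Real.sqrt (normSq g) := by
    calc Real.sqrt (∑ i, ‖X i‖ ^ 2) * Real.sqrt (∑ i, ‖Y i‖ ^ 2)
        ≤ (Real.sqrt (d * C) * Real.sqrt (normSq c)) * (Real.sqrt (d * C) * Real.sqrt (normSq g)) :=
          mul_le_mul hsX hsY (Real.sqrt_nonneg _) (by positivity)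
      _ = (Real.sqrt (d * C) * Real.sqrt (d * C)) * Real.sqrt (normSq c) * Real.sqrt (normSq g) := by ring
      _ = (d * C) * Real.sqrt (normSq c) * Real.sqrt (normSq g) := by rw [Real.mul_self_sqrt hC]
  have h := sum_norm_add_sq_ge X Y
  linarith

/-! ## §3 Proposition 7.1.2 at one momentum fibre -/

/-- ‖c + g‖² ≤ 2(‖c‖² + ‖g‖²) (we do not use the ( , )-orthogonality of (7.1.19b)). [cite: BalabanImbrieJaffe1985, (7.1.27) p.324] -/
theorem normSq_add_le (c g : Fin d → Fin d → ℂ) : normSq (c + g) ≤ 2 * (normSq c + normSq g) := by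
  unfold normSq
  rw [← Finset.sum_add_distrib, Finset.mul_sum]
  refine Finset.sum_le_sum fun μ _ => ?_
  rw [← Finset.sum_add_distrib, Finset.mul_sum]
  refine Finset.sum_le_sum fun ν _ => ?_
  rw [Pi.add_apply, Pi.add_apply]
  nlinarith [norm_add_le (c μ ν) (g μ ν), norm_nonneg (c μ ν + g μ ν), sq_nonneg (‖c μ ν‖ - ‖g μ ν‖)]

/-- **Proposition 7.1.2 at one momentum fibre** p. 324 [PDF 26], for the CONCRETE fibre form σ_k(p′) = τ₁(p′) + τ₂(p′) of
(7.1.13)–(7.1.16) (r15's `tau1Sym`, `tau2Sym`): at a momentum p′ with ∂^{(1)}(p′), ∂(p′ + l), Δ(p′ + l) ≠ 0 (the provisos of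
r15's (7.1.18)), φ(p′) > 0, N(p′) ≠ 0, and (7.1.23) in the form |a_λ(p′)|² ≤ c₂²φ_κ(p′) — IF a splitting f = ∂B + g satisfies the
two members of (7.1.21), ε‖g‖² ≤ ⟨g,τ₀(p′)g⟩ and ε‖∂B‖² ≤ ⟨∂B,τ₂(p′)∂B⟩, THEN c′‖f‖² ≤ ⟨f,σ_k(p′)f⟩ with
c′ = ¼·min{1,(ε/2M)²}·ε, M = d·c₂² (independent of p′ and k once ε, c₂ are).  The printed argument: (7.1.25) via
`tau1_form_reduce` + (7.1.28) `ineq7128` + hypothesis; 0 ≤ τ₂ (`tau2_nonneg`); the cross-term bound (`tau2_form_cross`);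
(7.1.26)–(7.1.27) = r15's `prop712_core`; finally ‖f‖² ≤ 2(‖∂B‖² + ‖g‖²) (the printed c = ½δε uses ( , )-orthogonality
instead; our c′ = c/2). [cite: BalabanImbrieJaffe1985, Prop. 7.1.2 p.324] -/
theorem prop712_fibre {η : ℝ} {M : ℕ} {p' : Fin d → ℝ} (hp : ∀ i : Fin d, dOne p' i ≠ 0)
    (hΔ : ∀ m ∈ lShifts d M, lapSym η (shiftMom p' m) ≠ 0)
    (hq : ∀ m ∈ lShifts d M, ∀ i : Fin d, dSym η (shiftMom p' m) i ≠ 0) (hφ : ∀ μ, 0 < phiSym η M p' μ)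
    (hN : enn (dOne p') (phiSym η M p') ≠ 0) {C : ℝ} (hC : 0 < C)
    (hc : ∀ l κ, ‖aSym η M p' l‖ ^ 2 ≤ C * phiSym η M p' κ) (hd : 0 < d) {ε : ℝ} (hε : 0 < ε)
    (B : Fin d → ℂ) (g : Fin d → Fin d → ℂ) (h21a : ε * normSq g ≤ (tensorInner g (tau0 η p') g).re)
    (h21b : ε * normSq (curlOne p' B) ≤ (tensorInner (curlOne p' B) (tau2Sym η M p') (curlOne p' B)).re) :
    1 / 4 * min 1 ((ε / (2 * (d * C))) ^ 2) * ε * normSq (curlOne p' B + g)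
      ≤ (tensorInner (curlOne p' B + g) (fun μ ν l κ => tau1Sym η M p' μ ν l κ + tau2Sym η M p' μ ν l κ)
          (curlOne p' B + g)).re := by
  set f := curlOne p' B + g with hf
  have hM : 0 < (d : ℝ) * C := mul_pos (by exact_mod_cast hd) hC
  -- S = T1 + T2
  have hS : (tensorInner f (fun μ ν l κ => tau1Sym η M p' μ ν l κ + tau2Sym η M p' μ ν l κ) f).re
      = (tensorInner f (tau1Sym η M p') f).re + (tensorInner f (tau2Sym η M p') f).re := by
    rw [tensorInner_add_kernel, Complex.add_re]
  -- (7.1.25): T1 = ⟨g,τ₁g⟩ ≥ ⟨g,τ₀g⟩ ≥ ε‖g‖²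
  have hT1 : ε * Real.sqrt (normSq g) ^ 2 ≤ (tensorInner f (tau1Sym η M p') f).re := by
    rw [Real.sq_sqrt (by unfold normSq; positivity), hf, tau1_form_reduce η M p' hp hΔ hq B g]
    exact h21a.trans (ineq7128 η M p' g)
  -- 0 ≤ τ₂, the cross-term bound, (7.1.21) on curls
  have hT2pos : 0 ≤ (tensorInner f (tau2Sym η M p') f).re := by
    rw [tau2Sym_eq_kernel]; exact (tau2_nonneg hφ hN _ f).1
  have hT2 : (tensorInner (curlOne p' B) (tau2Sym η M p') (curlOne p' B)).re
      - 2 * (d * C) * Real.sqrt (normSq (curlOne p' B)) * Real.sqrt (normSq g) ≤ (tensorInner f (tau2Sym η M p') f).re := by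
    rw [tau2Sym_eq_kernel, hf]; exact tau2_form_cross hφ hN hc (curlOne p' B) g
  have hcurl : ε * Real.sqrt (normSq (curlOne p' B)) ^ 2
      ≤ (tensorInner (curlOne p' B) (tau2Sym η M p') (curlOne p' B)).re := by
    rw [Real.sq_sqrt (by unfold normSq; positivity)]; exact h21b
  -- (7.1.26)–(7.1.27)
  have hcore := BIJ85Sect7Statements.prop712_core hε hM hS hT1 hT2pos hT2 hcurl
  rw [Real.sq_sqrt (by unfold normSq; positivity), Real.sq_sqrt (by unfold normSq; positivity)] at hcore
  -- ‖f‖² ≤ 2(‖g‖² + ‖∂B‖²)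
  have hn := normSq_add_le (curlOne p' B) g
  have hδ : 0 ≤ 1 / 4 * min 1 ((ε / (2 * (d * C))) ^ 2) * ε :=
    mul_nonneg (mul_nonneg (by norm_num) (le_min zero_le_one (sq_nonneg _))) hε.le
  calc 1 / 4 * min 1 ((ε / (2 * (d * C))) ^ 2) * ε * normSq (curlOne p' B + g)
      ≤ 1 / 4 * min 1 ((ε / (2 * (d * C))) ^ 2) * ε * (2 * (normSq (curlOne p' B) + normSq g)) :=
        mul_le_mul_of_nonneg_left hn hδ
    _ = 1 / 2 * min 1 ((ε / (2 * (d * C))) ^ 2) * ε * (normSq g + normSq (curlOne p' B)) := by ring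
    _ ≤ _ := hcore

end

end Literature.MathematicalPhysics.QuantumFieldTheory.BalabanImbrieJaffe1984to88.BIJ85Prop712Fibre
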